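import Summits.QuantumAdvantage.QuantumAdvantage.Theorems.SosSandwichPseudoBoundedAAClassicalCornerTribes
import Summits.QuantumAdvantage.QuantumAdvantage.Theorems.SosSandwichPseudoBoundedAASymmetricCornerExponents
import Mathlib.Analysis.SpecialFunctions.Pow.Real
import Mathlib.Analysis.Complex.Exponential
import HarnessLib

/-!
# Crux `PseudoBoundedAA` (stmt-QuantumAdvantage-15237, route SosSandwich) — ADMISSIBLE EXPONENTS ON THE CLASSICAL CORNER:
# a law `C·Var^a/T^b ≤ maxInf` on `R_T` needs `a ≥ 2 ∧ b ≥ 1`, holds for `a ≥ 2 ∧ b ≥ 2`; on single Boolean trees `b = 1` is exact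

Support file (`--supports stmt-QuantumAdvantage-15237`).  The classical corner `R_T ⊆ K_T` of the crux PB-AA (acceptance
probabilities of randomized classical algorithms with `≤ T` queries = probability mixtures of decision trees of depth `≤ T`,
`Theorems/SosSandwichPseudoBoundedAAClassicalCorner.lean`) obeys `16·Var² ≤ T²·maxInf` (OSSS + Cauchy–Schwarz), and the hands
g10–g12 conjectured the `(2,1)` law `16·Var² ≤ C·T·maxInf` there (proved on the nonadaptive, block-product and single-Boolean-tree
sub-corners).  This file pins the admissible REAL exponent pairs `(a, b)` of laws
`∃ C > 0, ∀ p ∈ R_T (T ≥ 1, Var > 0), ∃ i, C·Var[p]^a / T^b ≤ Infᵢ[p]` from both sides: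

* §1 `linearFamily_mixture` — the `T = 1` averaging algorithm "query a uniformly random variable and output it",
  `p_n = |x|/n`, is a mixture of `n` depth-`1` trees (`Var = 1/(4n)`, every `Inf = 1/n² = 16 Var²`, tree lemmas of
  `…SymmetricCornerExponents`);
* §2 `rpow_ge_min_of_mem_Icc`, **`tribes_defeats_subunit_T_exponent`** — the archimedean core: no constant `C > 0` and
  exponent `b < 1` survive the tribes calibrators (`Var ∈ [3/16, 1/4]`, every `Inf ≤ 2/2^w` on `T = 2^w·w` bits; `T^{1−b}`
  beats `2w = 2 log₂(T/w)` because `2^{δw} ≥ (δ w log 2)²/2`);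
* §3 **`classicalCorner_law_of_two_le`** (`a ≥ 2 ∧ b ≥ 2 ⟹` law, `C = 16`) and **`classicalCorner_law_only_if`**
  (law `⟹ a ≥ 2 ∧ b ≥ 1`): the admissible region of `R_T` lies between the quadrant `{a ≥ 2, b ≥ 2}` and `{a ≥ 2, b ≥ 1}`;
  the strip `1 ≤ b < 2` (at `a ≥ 2`) is EXACTLY the open `(2,1)`/`L²`-OSSS question of the classical corner;
* §4 the SINGLE-BOOLEAN-TREE sub-corner (total Boolean `f` with `D(f) ≤ T`): **`booleanTreeCorner_law_of_one_le`**
  (`a ≥ 1 ∧ b ≥ 1 ⟹` law with `C = 4`, OSSS `4·Var ≤ D(f)·maxInf`) and **`booleanTreeCorner_law_only_if`** (law `⟹ b ≥ 1`,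
  tribes): the `T`-exponent `1` of OSSS is optimal among all real exponents (OSSS's "tight up to the logarithm, by tribes").

Honest label: calibration of a corner of an open conjecture; no registered stub, crux or summit is closed.
Sources: O'Donnell–Saks–Schramm–Servedio FOCS 2005, Thm 1.1/3.2 and the tribes remark; Ben-Or–Linial FOCS 1985;
R. O'Donnell, *Analysis of Boolean Functions* (CUP 2014) §4.2, §8.6; Aaronson–Ambainis arXiv:0911.0996 Conj. 6.
-/

set_option linter.dupNamespace false

noncomputable section

namespace Summit.QuantumAdvantage.QuantumAdvantage.Theorems.SosSandwich

open Finset Function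
open Literature.Computability.Complexity Literature.Computability.QuantumComplexity

namespace ClassicalCornerCalibration

/-! ### §1 The `T = 1` averaging family is a mixture of depth-one trees -/

/-- **"Query a random variable and output it" is in `R_1`.** The degree-one family `p_n = |x|/n = Σᵢ (1/n)·Xᵢ` is on the
cube the uniform mixture of the `n` depth-`1` trees "read `xᵢ`, output it". [cite: OdonnellEtAl2005, Thm 3.2] -/
theorem linearFamily_mixture {n : ℕ} (hn : 1 ≤ n) :
    ∃ (m : ℕ) (w : Fin m → ℝ) (t : Fin m → DecisionTree n),
      (∀ k, 0 ≤ w k) ∧ ∑ k, w k = 1 ∧ (∀ k, (t k).depth ≤ 1) ∧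
        ∀ x : Fin n → Bool, evalBool (∑ i : Fin n, MvPolynomial.C (1 / (n : ℝ)) * MvPolynomial.X i) x =
          ∑ k, w k * (if (t k).eval x = true then (1 : ℝ) else 0) := by
  have hn0 : (n : ℝ) ≠ 0 := by exact_mod_cast (show n ≠ 0 by omega)
  refine ⟨n, fun _ => 1 / (n : ℝ), fun k => DecisionTree.query k (DecisionTree.leaf false) (DecisionTree.leaf true),
    fun _ => by positivity, ?_, fun _ => ?_, fun x => ?_⟩
  · rw [Finset.sum_const, Finset.card_univ, Fintype.card_fin, nsmul_eq_mul]
    field_simp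
  · simp [DecisionTree.depth_query, DecisionTree.depth_leaf]
  · rw [SymmetricCorner.evalBool_linearFamily]
    have hev : ∀ k : Fin n,
        (DecisionTree.query k (DecisionTree.leaf false) (DecisionTree.leaf true) : DecisionTree n).eval x = x k := by
      intro k
      rw [DecisionTree.eval_query, DecisionTree.eval_leaf, DecisionTree.eval_leaf]
      cases x k <;> rfl
    simp_rw [hev]
    rw [← Finset.mul_sum, Finset.sum_boole]
    field_simp

/-! ### §2 The archimedean core: tribes defeats every `T`-exponent below one -/

/-- A real power of a number in `[3/16, 1/4]` is at least `min((3/16)^a, (1/4)^a)`, whatever the sign of `a`. [folklore] -/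
theorem rpow_ge_min_of_mem_Icc {V a : ℝ} (hlo : 3 / 16 ≤ V) (hhi : V ≤ 1 / 4) :
    min ((3 / 16 : ℝ) ^ a) ((1 / 4 : ℝ) ^ a) ≤ V ^ a := by
  rcases le_or_gt 0 a with ha | ha
  · exact (min_le_left _ _).trans (Real.rpow_le_rpow (by norm_num) hlo ha)
  · have hV : 0 < V := lt_of_lt_of_le (by norm_num) hlo
    exact (min_le_right _ _).trans (Real.rpow_le_rpow_of_nonpos hV hhi ha.le)

/-- **Tribes defeats every sub-unit `T`-exponent.** There are no `C > 0`, real `a` and `b < 1` such that for every `w ≥ 1`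
some polynomial `p` on `2^w·w` bits with `Var[p] ∈ [3/16, 1/4]` and all influences `≤ 2/2^w` (the tribes calibrators) has
a variable with `C·Var[p]^a / (2^w·w)^b ≤ Infᵢ[p]`: indeed this would give `C·μ·(2^w)^{1−b'} ≤ 2w` with `μ > 0`,
`b' = max(b, 1/2) < 1`, while `(2^w)^{δ} = e^{δ w log 2} ≥ (δ w log 2)²/2`. [cite: ODonnell2014, §4.2] -/
theorem tribes_defeats_subunit_T_exponent {a b C : ℝ} (hC : 0 < C) (hb : b < 1)
    (h : ∀ w : ℕ, 1 ≤ w → ∃ p : MvPolynomial (Fin (2 ^ w * w)) ℝ,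
      3 / 16 ≤ boolVariance p ∧ boolVariance p ≤ 1 / 4 ∧ (∀ i, influence i p ≤ 2 / (2 : ℝ) ^ w) ∧
        ∃ i, C * boolVariance p ^ a / (((2 ^ w * w : ℕ) : ℝ)) ^ b ≤ influence i p) : False := by
  -- constants
  set μ : ℝ := min ((3 / 16 : ℝ) ^ a) ((1 / 4 : ℝ) ^ a) with hμ
  have hμ0 : 0 < μ := lt_min (Real.rpow_pos_of_pos (by norm_num) a) (Real.rpow_pos_of_pos (by norm_num) a)
  set b' : ℝ := max b (1 / 2) with hb'
  have hb'1 : b' < 1 := max_lt hb (by norm_num)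
  have hbb' : b ≤ b' := le_max_left _ _
  have hb'0 : 0 < b' := lt_of_lt_of_le (by norm_num) (le_max_right _ _)
  set δ : ℝ := 1 - b' with hδ
  have hδ0 : 0 < δ := by rw [hδ]; linarith
  have hlog : 0 < Real.log 2 := Real.log_pos one_lt_two
  -- the contradiction threshold
  set L : ℝ := 4 / (C * μ * (δ * Real.log 2) ^ 2) with hL
  have hL0 : 0 < L := by positivity
  obtain ⟨w₀, hw₀⟩ := exists_nat_gt L
  set w : ℕ := w₀ + 1 with hwdef
  have hw1 : 1 ≤ w := by omega
  have hwR : (w : ℝ) = w₀ + 1 := by rw [hwdef]; push_cast; ring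
  have hw0 : (0 : ℝ) < w := by rw [hwR]; positivity
  have hwL : L < w := by rw [hwR]; linarith
  have hw1R : (1 : ℝ) ≤ w := by exact_mod_cast hw1
  obtain ⟨p, hVlo, hVhi, hinf, i, hi⟩ := h w hw1
  -- name the quantities
  set V := boolVariance p with hV
  set S : ℝ := (2 : ℝ) ^ w with hS
  have hS0 : 0 < S := by positivity
  have hS1 : 1 ≤ S := one_le_pow₀ (by norm_num)
  set T : ℝ := ((2 ^ w * w : ℕ) : ℝ) with hT
  have hTSw : T = S * w := by rw [hT, hS]; push_cast; ring
  have hT1 : 1 ≤ T := by rw [hTSw]; exact one_le_mul_of_one_le_of_one_le hS1 hw1R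
  have hT0 : 0 < T := lt_of_lt_of_le one_pos hT1
  -- Step 1: `C μ / T^{b'} ≤ 2 / S`
  have hVa : μ ≤ V ^ a := rpow_ge_min_of_mem_Icc hVlo hVhi
  have hTb : T ^ b ≤ T ^ b' := Real.rpow_le_rpow_of_exponent_le hT1 hbb'
  have hTb0 : 0 < T ^ b := Real.rpow_pos_of_pos hT0 b
  have hTb'0 : 0 < T ^ b' := Real.rpow_pos_of_pos hT0 b'
  have h1 : C * μ / T ^ b' ≤ 2 / S := by
    calc C * μ / T ^ b' ≤ C * V ^ a / T ^ b' :=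
          div_le_div_of_nonneg_right (mul_le_mul_of_nonneg_left hVa hC.le) hTb'0.le
      _ ≤ C * V ^ a / T ^ b :=
          div_le_div_of_nonneg_left (mul_nonneg hC.le (le_trans hμ0.le hVa)) hTb0 hTb
      _ ≤ influence i p := hi
      _ ≤ 2 / S := hinf i
  -- Step 2: `T^{b'} = S^{b'} w^{b'} ≤ S^{b'} w`
  have hSb'0 : 0 < S ^ b' := Real.rpow_pos_of_pos hS0 b'
  have hwb' : (w : ℝ) ^ b' ≤ w := by
    calc (w : ℝ) ^ b' ≤ (w : ℝ) ^ (1 : ℝ) := Real.rpow_le_rpow_of_exponent_le hw1R hb'1.le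
      _ = w := Real.rpow_one _
  have hTb'le : T ^ b' ≤ S ^ b' * w := by
    rw [hTSw, Real.mul_rpow hS0.le hw0.le]
    exact mul_le_mul_of_nonneg_left hwb' hSb'0.le
  -- Step 3: `C μ S ≤ 2 S^{b'} w`, i.e. `C μ S^{δ} ≤ 2 w`
  have h2 : C * μ * S ≤ 2 * (S ^ b' * w) := by
    rw [div_le_div_iff₀ hTb'0 hS0] at h1
    calc C * μ * S ≤ 2 * T ^ b' := h1
      _ ≤ 2 * (S ^ b' * w) := by linarith
  have hSsplit : S = S ^ b' * S ^ δ := by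
    rw [← Real.rpow_add hS0, show b' + δ = (1 : ℝ) by rw [hδ]; ring, Real.rpow_one]
  have h3 : C * μ * S ^ δ ≤ 2 * w := by
    have h2' : S ^ b' * (C * μ * S ^ δ) ≤ S ^ b' * (2 * w) := by
      calc S ^ b' * (C * μ * S ^ δ) = C * μ * (S ^ b' * S ^ δ) := by ring
        _ = C * μ * S := by rw [← hSsplit]
        _ ≤ 2 * (S ^ b' * w) := h2
        _ = S ^ b' * (2 * w) := by ring
    exact le_of_mul_le_mul_left h2' hSb'0
  -- Step 4: `S^{δ} = exp(δ w log 2) ≥ (δ w log 2)²/2`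
  have hSδ : S ^ δ = Real.exp (δ * w * Real.log 2) := by
    rw [Real.rpow_def_of_pos hS0, hS, Real.log_pow]
    congr 1; ring
  have hy0 : 0 ≤ δ * w * Real.log 2 := by positivity
  have h4 : (δ * w * Real.log 2) ^ 2 / 2 ≤ S ^ δ := by
    rw [hSδ]
    have hq := Real.quadratic_le_exp_of_nonneg hy0
    linarith
  -- Step 5: combine: `C μ (δ log 2)² w² / 2 ≤ 2 w`, so `w ≤ L`
  have h5 : C * μ * ((δ * w * Real.log 2) ^ 2 / 2) ≤ 2 * w :=
    le_trans (mul_le_mul_of_nonneg_left h4 (by positivity)) h3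
  have h6 : (w : ℝ) ≤ L := by
    rw [hL, le_div_iff₀ (by positivity)]
    nlinarith [h5, hw0]
  linarith

/-! ### §3 The classical corner `R_T`: `{a ≥ 2, b ≥ 2} ⊆ admissible ⊆ {a ≥ 2, b ≥ 1}` -/

/-- **Sufficiency on `R_T`, `(2,2)` and weaker.** For `a ≥ 2` and `b ≥ 2` the law holds on the classical corner with
`C = 16` (`16 Var² ≤ T² maxInf`, `Var ≤ 1`, `T ≥ 1`). [cite: OdonnellEtAl2005, Thm 3.2] -/
theorem classicalCorner_law_of_two_le {a b : ℝ} (ha : 2 ≤ a) (hb : 2 ≤ b) :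
    ∃ C : ℝ, 0 < C ∧ ∀ (N T : ℕ) (p : MvPolynomial (Fin N) ℝ), 1 ≤ T →
      (∃ (m : ℕ) (w : Fin m → ℝ) (t : Fin m → DecisionTree N),
        (∀ k, 0 ≤ w k) ∧ ∑ k, w k = 1 ∧ (∀ k, (t k).depth ≤ T) ∧
          ∀ x : Fin N → Bool, evalBool p x = ∑ k, w k * (if (t k).eval x = true then (1 : ℝ) else 0)) →
      0 < boolVariance p → ∃ i : Fin N, C * boolVariance p ^ a / (T : ℝ) ^ b ≤ influence i p := by
  refine ⟨16, by norm_num, ?_⟩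
  intro N T p hT hmix hv
  obtain ⟨m, w, t, hw, hw1, htd, hp⟩ := hmix
  have hp' : ∀ x, evalBool p x = ∑ k ∈ Finset.univ, w k * (if (t k).eval x = true then (1 : ℝ) else 0) := hp
  obtain ⟨i, hi⟩ := ClassicalCorner.exists_influence_ge_of_mixture_depth_le Finset.univ w (fun k _ => hw k)
    (le_of_eq hw1) t T (fun k _ => htd k) p hp' hv
  refine ⟨i, ?_⟩
  have hpb : PseudoBounded T p := ClassicalCorner.pseudoBounded_of_mixture w hw hw1 t T htd p hp
  have hV1 : boolVariance p ≤ 1 := (boolVariance_le_quarter hpb).trans (by norm_num)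
  have hT1 : (1 : ℝ) ≤ (T : ℝ) := by exact_mod_cast hT
  have hVa : boolVariance p ^ a ≤ boolVariance p ^ 2 := by
    rw [← Real.rpow_two]
    exact Real.rpow_le_rpow_of_exponent_ge hv hV1 ha
  have hTb : (T : ℝ) ^ 2 ≤ (T : ℝ) ^ b := by
    rw [← Real.rpow_two]
    exact Real.rpow_le_rpow_of_exponent_le hT1 hb
  have hTb0 : (0 : ℝ) < (T : ℝ) ^ 2 := by positivity
  have hI := influence_nonneg i p
  calc 16 * boolVariance p ^ a / (T : ℝ) ^ b ≤ 16 * boolVariance p ^ 2 / (T : ℝ) ^ b :=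
        div_le_div_of_nonneg_right (by linarith) (le_trans hTb0.le hTb)
    _ ≤ 16 * boolVariance p ^ 2 / (T : ℝ) ^ 2 :=
        div_le_div_of_nonneg_left (by positivity) hTb0 hTb
    _ ≤ influence i p := by rw [div_le_iff₀ hTb0]; linarith

/-- **Necessity on `R_T`: `a ≥ 2 ∧ b ≥ 1`.** A law `C·Var^a/T^b ≤ maxInf` on the classical corner forces `a ≥ 2` (the
`T = 1` averaging family: `Var = 1/(4n) → 0` with all influences `16 Var²`) and `b ≥ 1` (the tribes calibrators: one
depth-`T` tree, `Var ≥ 3/16`, all influences `≤ 2 log₂T / T`). With `classicalCorner_law_of_two_le` the admissible region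
is squeezed between `{a ≥ 2, b ≥ 2}` and `{a ≥ 2, b ≥ 1}`; the strip in between is the open `(2,1)` question.
[cite: ODonnell2014, §4.2] [cite: OdonnellEtAl2005, Thm 3.2] -/
theorem classicalCorner_law_only_if (a b : ℝ)
    (hlaw : ∃ C : ℝ, 0 < C ∧ ∀ (N T : ℕ) (p : MvPolynomial (Fin N) ℝ), 1 ≤ T →
      (∃ (m : ℕ) (w : Fin m → ℝ) (t : Fin m → DecisionTree N),
        (∀ k, 0 ≤ w k) ∧ ∑ k, w k = 1 ∧ (∀ k, (t k).depth ≤ T) ∧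
          ∀ x : Fin N → Bool, evalBool p x = ∑ k, w k * (if (t k).eval x = true then (1 : ℝ) else 0)) →
      0 < boolVariance p → ∃ i : Fin N, C * boolVariance p ^ a / (T : ℝ) ^ b ≤ influence i p) :
    2 ≤ a ∧ 1 ≤ b := by
  obtain ⟨C, hC, h⟩ := hlaw
  constructor
  · -- `a ≥ 2`: the averaging family at `T = 1`
    by_contra hlt
    push Not at hlt
    have he : 0 < 2 - a := by linarith
    set L : ℝ := C / 16 with hL
    have hL0 : 0 < L := by positivity
    set M : ℝ := L ^ (1 / (2 - a)) with hM
    have hM0 : 0 < M := Real.rpow_pos_of_pos hL0 _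
    obtain ⟨n₀, hn₀⟩ := exists_nat_gt (1 / (4 * M))
    set n := n₀ + 1 with hndef
    have hn : 1 ≤ n := by omega
    have hnR : (1 / (4 * M) : ℝ) < n := by
      have : (n₀ : ℝ) < n := by rw [hndef]; push_cast; linarith
      linarith
    have hn0 : (0 : ℝ) < n := by exact_mod_cast (show 0 < n by omega)
    set x : ℝ := 1 / (4 * (n : ℝ)) with hx
    have hx0 : 0 < x := by positivity
    have hxM : x < M := by
      rw [hx, div_lt_iff₀ (by positivity)]
      rw [div_lt_iff₀ (by positivity)] at hnR
      linarith
    have hVpos : 0 < boolVariance (∑ i : Fin n, MvPolynomial.C (1 / (n : ℝ)) * MvPolynomial.X i) := by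
      rw [SymmetricCorner.boolVariance_linearFamily hn]; exact hx0
    obtain ⟨m, wt, t, hwt, hwt1, htd, hmix⟩ := linearFamily_mixture hn
    obtain ⟨i, hi⟩ := h n 1 _ le_rfl ⟨m, wt, t, hwt, hwt1, htd, hmix⟩ hVpos
    rw [SymmetricCorner.boolVariance_linearFamily hn, SymmetricCorner.influence_linearFamily, Nat.cast_one,
      Real.one_rpow, div_one] at hi
    have h16 : 1 / (n : ℝ) ^ 2 = 16 * x ^ 2 := by rw [hx]; field_simp; ring
    rw [h16] at hi
    have hxsplit : x ^ 2 = x ^ a * x ^ (2 - a) := by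
      rw [← Real.rpow_add hx0, show a + (2 - a) = (2 : ℝ) by ring]
      exact_mod_cast (Real.rpow_natCast x 2).symm
    have hxa : 0 < x ^ a := Real.rpow_pos_of_pos hx0 a
    have hle : L ≤ x ^ (2 - a) := by
      rw [hL, div_le_iff₀ (by norm_num : (0 : ℝ) < 16)]
      rw [hxsplit] at hi
      by_contra hcon
      push Not at hcon
      have : 16 * (x ^ a * x ^ (2 - a)) < x ^ a * C := by
        have := mul_lt_mul_of_pos_left hcon hxa
        nlinarith [this]
      nlinarith
    have hlt2 : x ^ (2 - a) < M ^ (2 - a) := Real.rpow_lt_rpow hx0.le hxM he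
    have hMe : M ^ (2 - a) = L := by
      rw [hM, ← Real.rpow_mul hL0.le, one_div_mul_cancel he.ne', Real.rpow_one]
    linarith [hMe ▸ hlt2]
  · -- `b ≥ 1`: the tribes calibrators
    by_contra hlt
    push Not at hlt
    refine tribes_defeats_subunit_T_exponent (a := a) hC hlt fun w hw => ?_
    obtain ⟨p, -, h01, hmix, hvar, hinf⟩ := exists_tribes_calibrator hw
    have hpos : (1 : ℕ) ≤ 2 ^ w * w := Nat.one_le_iff_ne_zero.mpr (by positivity)
    have hv : 0 < boolVariance p := lt_of_lt_of_le (by norm_num) hvar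
    obtain ⟨i, hi⟩ := h (2 ^ w * w) (2 ^ w * w) p hpos hmix hv
    have hbd : ∀ x, 0 ≤ evalBool p x ∧ evalBool p x ≤ 1 := by
      intro x; rcases h01 x with h0 | h0 <;> rw [h0] <;> norm_num
    exact ⟨p, hvar, SymmetricCorner.boolVariance_le_quarter hbd, hinf, i, hi⟩

/-! ### §4 The single-Boolean-tree sub-corner: the `T`-exponent is exactly `1` -/

/-- **Sufficiency on single Boolean trees (OSSS), `a ≥ 1 ∧ b ≥ 1`.** If `p` takes on the cube the `0/1` values of a
decision tree of depth `≤ T`, then `4·Var[p]/T ≤ maxᵢ Infᵢ[p]` (O'Donnell–Saks–Schramm–Servedio), hence every law with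
`a ≥ 1`, `b ≥ 1` holds with `C = 4` (`Var ≤ 1`, `T ≥ 1`). [cite: OdonnellEtAl2005, Thm 1.1] -/
theorem booleanTreeCorner_law_of_one_le {a b : ℝ} (ha : 1 ≤ a) (hb : 1 ≤ b) :
    ∃ C : ℝ, 0 < C ∧ ∀ (N T : ℕ) (p : MvPolynomial (Fin N) ℝ) (t : DecisionTree N), 1 ≤ T → t.depth ≤ T →
      (∀ x : Fin N → Bool, evalBool p x = if t.eval x = true then (1 : ℝ) else 0) →
      0 < boolVariance p → ∃ i : Fin N, C * boolVariance p ^ a / (T : ℝ) ^ b ≤ influence i p := by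
  refine ⟨4, by norm_num, ?_⟩
  intro N T p t hT htd hp hv
  have hpf : ∀ x, evalBool p x = realOf (fun x => t.eval x) x := fun x => by rw [hp x, realOf_apply]
  obtain ⟨j, hj⟩ := BooleanCorner.exists_influence_ge_of_decisionTree p (fun x => t.eval x) hpf hv
  have hD : (detQueryComplexity (fun x => t.eval x) : ℝ) ≤ T := by
    exact_mod_cast (detQueryComplexity_le_depth t (fun x => rfl)).trans htd
  refine ⟨j, ?_⟩
  have hI := influence_nonneg j p
  have hT1 : (1 : ℝ) ≤ (T : ℝ) := by exact_mod_cast hT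
  have hT0 : (0 : ℝ) < (T : ℝ) := by linarith
  have hbd : ∀ x, 0 ≤ evalBool p x ∧ evalBool p x ≤ 1 := by
    intro x; rw [hp x]; split_ifs <;> norm_num
  have hV1 : boolVariance p ≤ 1 := (SymmetricCorner.boolVariance_le_quarter hbd).trans (by norm_num)
  have hVa : boolVariance p ^ a ≤ boolVariance p := by
    calc boolVariance p ^ a ≤ boolVariance p ^ (1 : ℝ) := Real.rpow_le_rpow_of_exponent_ge hv hV1 ha
      _ = boolVariance p := Real.rpow_one _
  have hTb : (T : ℝ) ≤ (T : ℝ) ^ b := by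
    calc (T : ℝ) = (T : ℝ) ^ (1 : ℝ) := (Real.rpow_one _).symm
      _ ≤ (T : ℝ) ^ b := Real.rpow_le_rpow_of_exponent_le hT1 hb
  -- `4 Var/T ≤ Inf_j` from `Var ≤ D · Inf_j / 4 ≤ T · Inf_j / 4`
  have hkey : 4 * boolVariance p ≤ (T : ℝ) * influence j p := by
    have : boolVariance p ≤ (T : ℝ) * influence j p / 4 :=
      hj.trans (div_le_div_of_nonneg_right (mul_le_mul_of_nonneg_right hD hI) (by norm_num))
    linarith
  calc 4 * boolVariance p ^ a / (T : ℝ) ^ b ≤ 4 * boolVariance p / (T : ℝ) ^ b :=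
        div_le_div_of_nonneg_right (by linarith) (le_trans hT0.le hTb)
    _ ≤ 4 * boolVariance p / (T : ℝ) :=
        div_le_div_of_nonneg_left (by linarith [hv]) hT0 hTb
    _ ≤ influence j p := by rw [div_le_iff₀ hT0]; linarith

/-- **Necessity on single Boolean trees: `b ≥ 1`.** A law `C·Var^a/T^b ≤ maxInf` for all `0/1`-valued polynomials given by
one decision tree of depth `≤ T` forces `b ≥ 1`, whatever `a` (tribes: `Var ≥ 3/16`, all `Inf ≤ 2 log₂T/T`).  So on this
sub-corner the OSSS `T`-exponent `1` is optimal among all real exponents. [cite: ODonnell2014, §4.2]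
[cite: OdonnellEtAl2005, Thm 1.1] -/
theorem booleanTreeCorner_law_only_if (a b : ℝ)
    (hlaw : ∃ C : ℝ, 0 < C ∧ ∀ (N T : ℕ) (p : MvPolynomial (Fin N) ℝ) (t : DecisionTree N), 1 ≤ T → t.depth ≤ T →
      (∀ x : Fin N → Bool, evalBool p x = if t.eval x = true then (1 : ℝ) else 0) →
      0 < boolVariance p → ∃ i : Fin N, C * boolVariance p ^ a / (T : ℝ) ^ b ≤ influence i p) :
    1 ≤ b := by
  obtain ⟨C, hC, h⟩ := hlaw
  by_contra hlt
  push Not at hlt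
  refine tribes_defeats_subunit_T_exponent (a := a) hC hlt fun w hw => ?_
  obtain ⟨p, -, h01, -, hvar, hinf⟩ := exists_tribes_calibrator hw
  have hpos : (1 : ℕ) ≤ 2 ^ w * w := Nat.one_le_iff_ne_zero.mpr (by positivity)
  have hv : 0 < boolVariance p := lt_of_lt_of_le (by norm_num) hvar
  -- a single depth-`≤ N` tree for the Boolean function `x ↦ [p(x) = 1]`
  obtain ⟨t₁, ht₁, hd₁⟩ := DecisionTree.exists_computes_depth_le (fun x : Fin (2 ^ w * w) → Bool =>
    decide (evalBool p x = 1))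
  have hp : ∀ x, evalBool p x = if t₁.eval x = true then (1 : ℝ) else 0 := by
    intro x
    rw [ht₁ x]
    beta_reduce
    by_cases h1 : evalBool p x = 1
    · rw [decide_eq_true h1, if_pos rfl, h1]
    · rw [decide_eq_false h1, if_neg Bool.false_ne_true]
      exact (h01 x).resolve_right h1
  obtain ⟨i, hi⟩ := h (2 ^ w * w) (2 ^ w * w) p t₁ hpos hd₁ hp hv
  have hbd : ∀ x, 0 ≤ evalBool p x ∧ evalBool p x ≤ 1 := by
    intro x; rcases h01 x with h0 | h0 <;> rw [h0] <;> norm_num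
  exact ⟨p, hvar, SymmetricCorner.boolVariance_le_quarter hbd, hinf, i, hi⟩

end ClassicalCornerCalibration

end Summit.QuantumAdvantage.QuantumAdvantage.Theorems.SosSandwich

end
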